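import Summits.HubbardSuperconductivity.HubbardSuperconductivity.Theorems.NodalDiracTwistNodalDiracWeakCouplingConeEnergyRay

/-!
# Route `NodalDiracTwist` — crux `NodalDiracWeakCoupling`: stub `stub_coneEnergy`

Helper file for stmt-HubbardSuperconductivity-10370 (`NodalDiracWeakCoupling`), proving the stub
`stub_coneEnergy` (M2) of the line `birth`: the first-order energy estimates at a two-fold
degenerate lowest sector eigenvalue (Kato, *Perturbation Theory for Linear Operators* (1966),
II §5: the degenerate eigenvalue splits to first order according to the compression `P V P`).
Setting: a sector `K`, a family `H φ` (`φ ∈ ℝ²`) with the variational lower bound `hlb` and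
existence `hex` of sector ground states, `H p` Hermitian with an orthonormal pair `e₁, e₂ ∈ K` of
ground states and a gap `g` above them on `K ∩ {e₁, e₂}^⊥`, first-order data `V 0, V 1` at `p`
(sesquilinear Taylor bound `hTaylor`, form bound `C`). For a unit direction `u` the pencil data are
`a(u) = (re ⟨e₁, V_u e₁⟩ - re ⟨e₂, V_u e₂⟩)/2`, `b(u) = (⟨e₁, V_u e₂⟩ + conj ⟨e₂, V_u e₁⟩)/2`,
`V_u = u₀ V 0 + u₁ V 1`. Along the ray `p + r u` the two-sided first-order estimate
`cone_line_core` (`NodalDiracTwistNodalDiracWeakCouplingConeEnergyRay`: `g t² + r D ≤ 2εr + 8Crt`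
and the test-vector bound) gives
(ii) CLOSENESS (`cone_closeness`): the weight `t² = 1 - |c₁|² - |c₂|²` of a unit ground state at
`p + ru` outside the plane and its deviation `D` from the lower eigenline are `≤ η` for
`r ≤ r₁(η)`; and (i) NONDEGENERACY (`cone_nondegeneracy`): a cone of slope `m` on the energies of
unit sector vectors orthogonal to the ground state forces `a(u)² + |b(u)|² ≥ (m/2)²` (test the cone
with the unit vector of the plane orthogonal to the ground state's plane component).
No new definitions.
-/

-- the mandated namespace `Summit.<Summit>.<Problem>.Theorems` repeats `HubbardSuperconductivity`
-- (single-problem summit, D-0017), which the `dupNamespace` linter flags on every declaration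
set_option linter.dupNamespace false

namespace Summit.HubbardSuperconductivity.HubbardSuperconductivity.Theorems.NodalDiracTwist

open Matrix Complex Literature.MathematicalPhysics.QuantumLattice
open scoped ComplexOrder

variable {ι : Type*} [Fintype ι]

/-! ### (ii) Closeness of the ground states to the lower eigenline -/

/-- **Closeness.** For every `η > 0` there is `r₁ > 0` such that for `0 < r ≤ r₁`, every unit
direction `u` and every unit sector ground state `ψ` at `p + r u` (frame weights
`c_k = ⟨e_k, ψ⟩`): `1 - |c₁|² - |c₂|² ≤ η` and the deviation
`√(a² + |b|²)(|c₁|² + |c₂|²) + a(|c₁|² - |c₂|²) + 2 re(c̄₁ c₂ b) ≤ η`. From (1) of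
`cone_line_core` with `ε = η/4`: `g t² ≤ r (2ε + 8C)` and `D ≤ 2ε + 8 C t`. [folklore] -/
theorem cone_closeness (K : Submodule ℂ (ι → ℂ)) (H : (Fin 2 → ℝ) → Matrix ι ι ℂ)
    (p : Fin 2 → ℝ) (hHerm : (H p).IsHermitian)
    (hlb : ∀ φ, ∀ v ∈ K, star v ⬝ᵥ v = 1 → (H φ).minEnergyOn K ≤ (star v ⬝ᵥ H φ *ᵥ v).re)
    (V : Fin 2 → Matrix ι ι ℂ) (C : ℝ)
    (hCV : ∀ (μ : Fin 2) (x w : ι → ℂ), star x ⬝ᵥ x = 1 → star w ⬝ᵥ w = 1 →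
      ‖star x ⬝ᵥ (V μ *ᵥ w)‖ ≤ C)
    (hTaylor : ∀ ε : ℝ, 0 < ε → ∃ δ : ℝ, 0 < δ ∧ ∀ y : Fin 2 → ℝ,
      Real.sqrt (y 0 ^ 2 + y 1 ^ 2) ≤ δ → ∀ x w : ι → ℂ, star x ⬝ᵥ x = 1 → star w ⬝ᵥ w = 1 →
        ‖star x ⬝ᵥ ((H (fun ν => p ν + y ν) - H p -
            (((y 0 : ℝ) : ℂ) • V 0 + ((y 1 : ℝ) : ℂ) • V 1)) *ᵥ w)‖ ≤
          ε * Real.sqrt (y 0 ^ 2 + y 1 ^ 2))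
    {e₁ e₂ : ι → ℂ} (he₁K : e₁ ∈ K) (he₂K : e₂ ∈ K) (he₁ : star e₁ ⬝ᵥ e₁ = 1)
    (he₂ : star e₂ ⬝ᵥ e₂ = 1) (he₁₂ : star e₁ ⬝ᵥ e₂ = 0)
    (hHe₁ : H p *ᵥ e₁ = (((H p).minEnergyOn K : ℝ) : ℂ) • e₁)
    (hHe₂ : H p *ᵥ e₂ = (((H p).minEnergyOn K : ℝ) : ℂ) • e₂) {g : ℝ} (hg : 0 < g)
    (hgap : ∀ χ ∈ K, star e₁ ⬝ᵥ χ = 0 → star e₂ ⬝ᵥ χ = 0 → star χ ⬝ᵥ χ = 1 →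
      (H p).minEnergyOn K + g ≤ (star χ ⬝ᵥ H p *ᵥ χ).re) {η : ℝ} (hη : 0 < η) :
    ∃ r₁ : ℝ, 0 < r₁ ∧ ∀ r : ℝ, 0 < r → r ≤ r₁ →
      ∀ u : Fin 2 → ℝ, u 0 ^ 2 + u 1 ^ 2 = 1 → ∀ (a : ℝ) (b : ℂ),
        a = ((star e₁ ⬝ᵥ ((((u 0 : ℝ) : ℂ) • V 0 + ((u 1 : ℝ) : ℂ) • V 1) *ᵥ e₁)).re -
              (star e₂ ⬝ᵥ ((((u 0 : ℝ) : ℂ) • V 0 + ((u 1 : ℝ) : ℂ) • V 1) *ᵥ e₂)).re) / 2 →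
        b = (star e₁ ⬝ᵥ ((((u 0 : ℝ) : ℂ) • V 0 + ((u 1 : ℝ) : ℂ) • V 1) *ᵥ e₂) +
              star (star e₂ ⬝ᵥ ((((u 0 : ℝ) : ℂ) • V 0 + ((u 1 : ℝ) : ℂ) • V 1) *ᵥ e₁))) / 2 →
        ∀ ψ : ι → ℂ,
          (ψ ∈ K ∧ ψ ≠ 0 ∧ H (fun ν => p ν + r * u ν) *ᵥ ψ =
            (((H (fun ν => p ν + r * u ν)).minEnergyOn K : ℝ) : ℂ) • ψ) →
          star ψ ⬝ᵥ ψ = 1 →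
            1 - ‖star e₁ ⬝ᵥ ψ‖ ^ 2 - ‖star e₂ ⬝ᵥ ψ‖ ^ 2 ≤ η ∧
            Real.sqrt (a ^ 2 + ‖b‖ ^ 2) * (‖star e₁ ⬝ᵥ ψ‖ ^ 2 + ‖star e₂ ⬝ᵥ ψ‖ ^ 2) +
                a * (‖star e₁ ⬝ᵥ ψ‖ ^ 2 - ‖star e₂ ⬝ᵥ ψ‖ ^ 2) +
                2 * (starRingEnd ℂ (star e₁ ⬝ᵥ ψ) * (star e₂ ⬝ᵥ ψ) * b).re ≤ η := by
  have hC : 0 ≤ C := (norm_nonneg _).trans (hCV 0 e₁ e₁ he₁ he₁)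
  obtain ⟨δ, hδ0, hδ⟩ := hTaylor (η / 4) (by positivity)
  -- constants: `M` bounds `2ε + 8 C t + 1`, `η'` makes both `t² ≤ η` and `8 C t ≤ η / 2`
  obtain ⟨M, hM⟩ : ∃ M : ℝ, 2 * (η / 4) + 8 * C + 1 = M := ⟨_, rfl⟩
  have hM0 : 0 < M := by rw [← hM]; positivity
  obtain ⟨η', hη'⟩ : ∃ η' : ℝ, min η (η ^ 2 / (256 * C ^ 2 + 1)) = η' := ⟨_, rfl⟩
  have hη'0 : 0 < η' := hη' ▸ lt_min hη (by positivity)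
  have hη'1 : η' ≤ η := hη' ▸ min_le_left _ _
  have hη'2 : η' ≤ η ^ 2 / (256 * C ^ 2 + 1) := hη' ▸ min_le_right _ _
  refine ⟨min δ (η' * g / M), lt_min hδ0 (by positivity), ?_⟩
  intro r hr hr₁ u hu a b ha hb ψ hψ hψ1
  have hrδ : r ≤ δ := hr₁.trans (min_le_left _ _)
  have hrM : r * M ≤ η' * g := by
    have h := hr₁.trans (min_le_right _ _)
    rwa [le_div_iff₀ hM0] at h
  obtain ⟨h1, -⟩ := cone_line_core K H p hHerm hlb V hC hCV he₁K he₂K he₁ he₂ he₁₂ hHe₁ hHe₂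
    hg.le hgap hδ hr hrδ hu ha hb hψ hψ1
  -- name the weights
  have hS1 := frame_weight_le_one he₁ he₂ he₁₂ hψ1
  obtain ⟨c₁, hc₁⟩ : ∃ c, star e₁ ⬝ᵥ ψ = c := ⟨_, rfl⟩
  obtain ⟨c₂, hc₂⟩ : ∃ c, star e₂ ⬝ᵥ ψ = c := ⟨_, rfl⟩
  rw [hc₁, hc₂] at h1 hS1 ⊢
  obtain ⟨ρ, hρ⟩ : ∃ ρ : ℝ, Real.sqrt (a ^ 2 + ‖b‖ ^ 2) = ρ := ⟨_, rfl⟩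
  have hD0 : 0 ≤ ρ * (‖c₁‖ ^ 2 + ‖c₂‖ ^ 2) +
      (a * (‖c₁‖ ^ 2 - ‖c₂‖ ^ 2) + 2 * (starRingEnd ℂ c₁ * c₂ * b).re) := by
    have h := (abs_le.1 (hρ ▸ abs_pencil_le a b c₁ c₂)).1
    linarith
  rw [hρ] at h1 ⊢
  obtain ⟨t, ht⟩ : ∃ t : ℝ, Real.sqrt (1 - ‖c₁‖ ^ 2 - ‖c₂‖ ^ 2) = t := ⟨_, rfl⟩
  rw [ht] at h1
  have h0 : 0 ≤ 1 - ‖c₁‖ ^ 2 - ‖c₂‖ ^ 2 := by linarith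
  have ht0 : 0 ≤ t := ht ▸ Real.sqrt_nonneg _
  have ht1 : t ≤ 1 := by
    rw [← ht, Real.sqrt_le_one]
    nlinarith [norm_nonneg c₁, norm_nonneg c₂]
  have htt : t ^ 2 = 1 - ‖c₁‖ ^ 2 - ‖c₂‖ ^ 2 := by rw [← ht, Real.sq_sqrt h0]
  -- `g t² ≤ r M ≤ η' g`, so `t² ≤ η' ≤ η`
  have hgt : g * (1 - ‖c₁‖ ^ 2 - ‖c₂‖ ^ 2) ≤ r * M := by
    have hrD := mul_nonneg hr.le hD0
    have hCrt : C * r * t ≤ C * r * 1 := mul_le_mul_of_nonneg_left ht1 (mul_nonneg hC hr.le)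
    rw [← hM]
    linarith
  have ht2η' : 1 - ‖c₁‖ ^ 2 - ‖c₂‖ ^ 2 ≤ η' := le_of_mul_le_mul_left (by linarith) hg
  refine ⟨ht2η'.trans hη'1, ?_⟩
  -- `D ≤ 2ε + 8 C t` and `8 C t ≤ η / 2`
  have hD : ρ * (‖c₁‖ ^ 2 + ‖c₂‖ ^ 2) +
      (a * (‖c₁‖ ^ 2 - ‖c₂‖ ^ 2) + 2 * (starRingEnd ℂ c₁ * c₂ * b).re) ≤
      2 * (η / 4) + 8 * C * t := by
    refine le_of_mul_le_mul_left ?_ hr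
    have hgt0 := mul_nonneg hg.le h0
    linarith
  have h8 : 8 * C * t ≤ η / 2 := eight_mul_le_half (htt.le.trans ht2η') hη'2 hη.le
  linarith

/-! ### (i) Nondegeneracy of the pencil from the cone -/

/-- **Nondegeneracy.** If on a punctured disk about `p` every unit sector vector orthogonal to a
sector ground state at `φ` has energy `≥ minEnergyOn + m |φ - p|` (`m > 0`), then
`a(u)² + |b(u)|² ≥ (m/2)²` for every unit direction `u`. For small `r` take a unit ground state
`ψ = c₁e₁ + c₂e₂ + χ` at `p + r u` (`‖χ‖² ≤ η` by `cone_closeness`) and the unit vector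
`e ∝ c̄₂ e₁ - c̄₁ e₂` of the plane, orthogonal to `ψ`: the cone gives
`re ⟨e, H e⟩ ≥ minEnergyOn + m r`, while (2) of `cone_line_core` gives
`re ⟨e, H e⟩ ≤ minEnergyOn + 2ρ r + 2ε r + 8 C r ‖χ‖`; so `m ≤ 2ρ + 2ε + 8C√η` for all small
`ε, η`. [folklore] -/
theorem cone_nondegeneracy (K : Submodule ℂ (ι → ℂ)) (H : (Fin 2 → ℝ) → Matrix ι ι ℂ)
    (p : Fin 2 → ℝ) (hHerm : (H p).IsHermitian)
    (hlb : ∀ φ, ∀ v ∈ K, star v ⬝ᵥ v = 1 → (H φ).minEnergyOn K ≤ (star v ⬝ᵥ H φ *ᵥ v).re)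
    (hex : ∀ φ, ∃ v ∈ K, v ≠ 0 ∧ H φ *ᵥ v = (((H φ).minEnergyOn K : ℝ) : ℂ) • v)
    (V : Fin 2 → Matrix ι ι ℂ) (C : ℝ)
    (hCV : ∀ (μ : Fin 2) (x w : ι → ℂ), star x ⬝ᵥ x = 1 → star w ⬝ᵥ w = 1 →
      ‖star x ⬝ᵥ (V μ *ᵥ w)‖ ≤ C)
    (hTaylor : ∀ ε : ℝ, 0 < ε → ∃ δ : ℝ, 0 < δ ∧ ∀ y : Fin 2 → ℝ,
      Real.sqrt (y 0 ^ 2 + y 1 ^ 2) ≤ δ → ∀ x w : ι → ℂ, star x ⬝ᵥ x = 1 → star w ⬝ᵥ w = 1 →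
        ‖star x ⬝ᵥ ((H (fun ν => p ν + y ν) - H p -
            (((y 0 : ℝ) : ℂ) • V 0 + ((y 1 : ℝ) : ℂ) • V 1)) *ᵥ w)‖ ≤
          ε * Real.sqrt (y 0 ^ 2 + y 1 ^ 2))
    {e₁ e₂ : ι → ℂ} (he₁K : e₁ ∈ K) (he₂K : e₂ ∈ K) (he₁ : star e₁ ⬝ᵥ e₁ = 1)
    (he₂ : star e₂ ⬝ᵥ e₂ = 1) (he₁₂ : star e₁ ⬝ᵥ e₂ = 0)
    (hHe₁ : H p *ᵥ e₁ = (((H p).minEnergyOn K : ℝ) : ℂ) • e₁)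
    (hHe₂ : H p *ᵥ e₂ = (((H p).minEnergyOn K : ℝ) : ℂ) • e₂) {g : ℝ} (hg : 0 < g)
    (hgap : ∀ χ ∈ K, star e₁ ⬝ᵥ χ = 0 → star e₂ ⬝ᵥ χ = 0 → star χ ⬝ᵥ χ = 1 →
      (H p).minEnergyOn K + g ≤ (star χ ⬝ᵥ H p *ᵥ χ).re)
    {m ρc : ℝ} (hm : 0 < m) (hρc : 0 < ρc)
    (hcone : ∀ φ : Fin 2 → ℝ, 0 < (φ 0 - p 0) ^ 2 + (φ 1 - p 1) ^ 2 →
      (φ 0 - p 0) ^ 2 + (φ 1 - p 1) ^ 2 ≤ ρc ^ 2 → ∀ ψ χ : ι → ℂ,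
        (ψ ∈ K ∧ ψ ≠ 0 ∧ H φ *ᵥ ψ = (((H φ).minEnergyOn K : ℝ) : ℂ) • ψ) →
        χ ∈ K → star ψ ⬝ᵥ χ = 0 → star χ ⬝ᵥ χ = 1 →
          (H φ).minEnergyOn K + m * Real.sqrt ((φ 0 - p 0) ^ 2 + (φ 1 - p 1) ^ 2) ≤
            (star χ ⬝ᵥ (H φ *ᵥ χ)).re)
    {u : Fin 2 → ℝ} (hu : u 0 ^ 2 + u 1 ^ 2 = 1) {a : ℝ} {b : ℂ}
    (ha : a = ((star e₁ ⬝ᵥ ((((u 0 : ℝ) : ℂ) • V 0 + ((u 1 : ℝ) : ℂ) • V 1) *ᵥ e₁)).re -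
      (star e₂ ⬝ᵥ ((((u 0 : ℝ) : ℂ) • V 0 + ((u 1 : ℝ) : ℂ) • V 1) *ᵥ e₂)).re) / 2)
    (hb : b = (star e₁ ⬝ᵥ ((((u 0 : ℝ) : ℂ) • V 0 + ((u 1 : ℝ) : ℂ) • V 1) *ᵥ e₂) +
      star (star e₂ ⬝ᵥ ((((u 0 : ℝ) : ℂ) • V 0 + ((u 1 : ℝ) : ℂ) • V 1) *ᵥ e₁))) / 2) :
    (m / 2) ^ 2 ≤ a ^ 2 + ‖b‖ ^ 2 := by
  have hC : 0 ≤ C := (norm_nonneg _).trans (hCV 0 e₁ e₁ he₁ he₁)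
  obtain ⟨ρ, hρ⟩ : ∃ ρ : ℝ, Real.sqrt (a ^ 2 + ‖b‖ ^ 2) = ρ := ⟨_, rfl⟩
  have hρ0 : 0 ≤ ρ := hρ ▸ Real.sqrt_nonneg _
  have hρ2 : ρ ^ 2 = a ^ 2 + ‖b‖ ^ 2 := by rw [← hρ, Real.sq_sqrt (by positivity)]
  -- it suffices that `m ≤ 2ρ + ε'` for every `ε' > 0`
  suffices hmρ : m ≤ 2 * ρ by
    rw [← hρ2]
    exact pow_le_pow_left₀ (by positivity) (by linarith) 2
  refine le_of_forall_pos_le_add fun ε' hε' => ?_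
  -- accuracy `ε = ε'/4` for the Taylor remainder, `η` for the closeness
  obtain ⟨δ, hδ0, hδ⟩ := hTaylor (ε' / 4) (by positivity)
  obtain ⟨η, hη⟩ : ∃ η : ℝ, min (1 / 2) (ε' ^ 2 / (256 * C ^ 2 + 1)) = η := ⟨_, rfl⟩
  have hη0 : 0 < η := hη ▸ lt_min (by norm_num) (by positivity)
  have hη1 : η ≤ 1 / 2 := hη ▸ min_le_left _ _
  have hη2 : η ≤ ε' ^ 2 / (256 * C ^ 2 + 1) := hη ▸ min_le_right _ _
  obtain ⟨r₁, hr₁0, hr₁⟩ := cone_closeness K H p hHerm hlb V C hCV hTaylor he₁K he₂K he₁ he₂ he₁₂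
    hHe₁ hHe₂ hg hgap hη0
  -- the radius
  obtain ⟨r, hr⟩ : ∃ r : ℝ, min δ (min ρc r₁) = r := ⟨_, rfl⟩
  have hr0 : 0 < r := hr ▸ lt_min hδ0 (lt_min hρc hr₁0)
  have hrδ : r ≤ δ := hr ▸ min_le_left _ _
  have hrρc : r ≤ ρc := hr ▸ (min_le_right _ _).trans (min_le_left _ _)
  have hrr₁ : r ≤ r₁ := hr ▸ (min_le_right _ _).trans (min_le_right _ _)
  -- a unit sector ground state at `p + r u`
  obtain ⟨ψ₀, hψ₀K, hψ₀0, hHψ₀⟩ := hex (fun ν => p ν + r * u ν)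
  obtain ⟨c, hc0, -, hc1⟩ := EigenvalueContinuation.exists_normalize hψ₀0
  have hψg : ((c : ℂ) • ψ₀) ∈ K ∧ (c : ℂ) • ψ₀ ≠ 0 ∧
      H (fun ν => p ν + r * u ν) *ᵥ ((c : ℂ) • ψ₀) =
        (((H (fun ν => p ν + r * u ν)).minEnergyOn K : ℝ) : ℂ) • ((c : ℂ) • ψ₀) :=
    ⟨K.smul_mem _ hψ₀K, smul_ne_zero (Complex.ofReal_ne_zero.2 hc0.ne') hψ₀0,
      by rw [mulVec_smul, hHψ₀, smul_comm]⟩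
  obtain ⟨ψ, hψ⟩ : ∃ ψ : ι → ℂ, (c : ℂ) • ψ₀ = ψ := ⟨_, rfl⟩
  rw [hψ] at hψg hc1
  -- closeness: `1 - |c₁|² - |c₂|² ≤ η`; core (2): the test-vector bound
  obtain ⟨hclose, -⟩ := hr₁ r hr0 hrr₁ u hu a b ha hb ψ hψg hc1
  obtain ⟨-, h2⟩ := cone_line_core K H p hHerm hlb V hC hCV he₁K he₂K he₁ he₂ he₁₂ hHe₁ hHe₂
    hg.le hgap hδ hr0 hrδ hu ha hb hψg hc1
  rw [hρ] at h2
  obtain ⟨hψK, hψ0, hHψ⟩ := hψg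
  obtain ⟨c₁, hc₁⟩ : ∃ z, star e₁ ⬝ᵥ ψ = z := ⟨_, rfl⟩
  obtain ⟨c₂, hc₂⟩ : ∃ z, star e₂ ⬝ᵥ ψ = z := ⟨_, rfl⟩
  rw [hc₁, hc₂] at hclose h2
  -- the weight in the plane is `S ≥ 1/2`
  obtain ⟨S, hS⟩ : ∃ S : ℝ, ‖c₁‖ ^ 2 + ‖c₂‖ ^ 2 = S := ⟨_, rfl⟩
  have hS0 : 1 / 2 ≤ S := by linarith
  have hSpos : 0 < S := by linarith
  obtain ⟨t, ht⟩ : ∃ t : ℝ, Real.sqrt (1 - ‖c₁‖ ^ 2 - ‖c₂‖ ^ 2) = t := ⟨_, rfl⟩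
  rw [ht] at h2
  have h0 : 0 ≤ 1 - ‖c₁‖ ^ 2 - ‖c₂‖ ^ 2 := by
    have h := frame_weight_le_one he₁ he₂ he₁₂ hc1
    rw [hc₁, hc₂] at h
    linarith
  have ht0 : 0 ≤ t := ht ▸ Real.sqrt_nonneg _
  have htt : t ^ 2 = 1 - ‖c₁‖ ^ 2 - ‖c₂‖ ^ 2 := by rw [← ht, Real.sq_sqrt h0]
  -- the unit test vector `e = (c̄₂ e₁ - c̄₁ e₂)/√S`, orthogonal to `ψ`
  obtain ⟨n, hn⟩ : ∃ n : ℝ, (Real.sqrt S)⁻¹ = n := ⟨_, rfl⟩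
  have hn0 : 0 < n := hn ▸ inv_pos.2 (Real.sqrt_pos.2 hSpos)
  have hn2 : n ^ 2 * S = 1 := by
    rw [← hn, inv_pow, Real.sq_sqrt hSpos.le, inv_mul_cancel₀ hSpos.ne']
  have hx : ‖(n : ℂ) * starRingEnd ℂ c₂‖ ^ 2 + ‖-((n : ℂ) * starRingEnd ℂ c₁)‖ ^ 2 = 1 := by
    rw [norm_neg, norm_mul, norm_mul, Complex.norm_conj, Complex.norm_conj, Complex.norm_real,
      Real.norm_eq_abs, abs_of_pos hn0]
    linear_combination hn2 + n ^ 2 * hS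
  have heK : ((n : ℂ) * starRingEnd ℂ c₂) • e₁ + (-((n : ℂ) * starRingEnd ℂ c₁)) • e₂ ∈ K :=
    K.add_mem (K.smul_mem _ he₁K) (K.smul_mem _ he₂K)
  have he1 := frame_unit he₁ he₂ he₁₂ hx
  have hψe : star ψ ⬝ᵥ (((n : ℂ) * starRingEnd ℂ c₂) • e₁ + (-((n : ℂ) * starRingEnd ℂ c₁)) • e₂) =
      0 := by
    rw [dotProduct_frame, star_dotProduct_comm_conj e₁ ψ, star_dotProduct_comm_conj e₂ ψ, hc₁, hc₂]
    ring
  -- the cone at `φ = p + r u` with the pair `(ψ, e)`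
  have hdist : (p 0 + r * u 0 - p 0) ^ 2 + (p 1 + r * u 1 - p 1) ^ 2 = r ^ 2 := dir_dist_sq p r hu
  have hc : (H (fun ν => p ν + r * u ν)).minEnergyOn K +
      m * Real.sqrt ((p 0 + r * u 0 - p 0) ^ 2 + (p 1 + r * u 1 - p 1) ^ 2) ≤
      (star (((n : ℂ) * starRingEnd ℂ c₂) • e₁ + (-((n : ℂ) * starRingEnd ℂ c₁)) • e₂) ⬝ᵥ
        (H (fun ν => p ν + r * u ν) *ᵥ
          (((n : ℂ) * starRingEnd ℂ c₂) • e₁ + (-((n : ℂ) * starRingEnd ℂ c₁)) • e₂))).re :=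
    hcone (fun ν => p ν + r * u ν) (by rw [hdist]; positivity)
      (by rw [hdist]; exact pow_le_pow_left₀ hr0.le hrρc 2) ψ _ ⟨hψK, hψ0, hHψ⟩ heK hψe he1
  rw [hdist, Real.sqrt_sq hr0.le] at hc
  have hup := h2 _ _ hx
  -- `m r ≤ 2ρ r + 2 ε r + 8 C r t`, divide by `r`, and `8 C t ≤ ε'/2`
  have hmr : m ≤ 2 * ρ + 2 * (ε' / 4) + 8 * C * t := by
    refine le_of_mul_le_mul_left ?_ hr0
    linarith
  have h8 : 8 * C * t ≤ ε' / 2 := eight_mul_le_half (htt.le.trans hclose) hη2 hε'.le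
  linarith

/-! ### The stub -/

/-- **STUB M2 — `stub_coneEnergy` (first-order energy estimates at a conical crossing).**
Setting: sector `K`, family `H φ` with the variational bound `hlb` and existence `hex` of
sector ground states, `H p` Hermitian; an orthonormal pair `e₁, e₂ ∈ K` of ground states of `H p`
(energy `E₀ = minEnergyOn (H p) K`) with a gap `g` above `E₀` on `K ∩ {e₁,e₂}^⊥`; first-order data
`V 0, V 1` at `p` with the Taylor bound (sesquilinear form of `H(p+y) - H(p) - y·V` is `o(|y|)` on
unit vectors) and a form bound `C`. For a unit direction `u` put `V_u = u₀ V 0 + u₁ V 1`,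
`a(u) = (Re⟨e₁, V_u e₁⟩ - Re⟨e₂, V_u e₂⟩)/2`, `b(u) = (⟨e₁, V_u e₂⟩ + conj ⟨e₂, V_u e₁⟩)/2` (the
traceless Hermitian part `[[a, b], [b̄, -a]]` of the compression, eigenvalues `±√(a² + |b|²)`).
(i) NONDEGENERACY: if the cone inequality with slope `m` holds on a punctured disk about `p` (every
unit sector vector orthogonal to a ground state at `φ` has energy `≥ minEnergyOn + m|φ - p|`), then
`a(u)² + |b(u)|² ≥ (m/2)²` for every unit `u` (`cone_nondegeneracy`).
(ii) CLOSENESS: for every `η > 0` there is `r₁ > 0` such that for `0 < r ≤ r₁`, every unit `u` and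
every unit sector ground state `ψ` at `p + r u`, with `c_k = ⟨e_k, ψ⟩`: the weight outside the frame
`1 - |c₁|² - |c₂|²` is `≤ η` and the deviation form
`√(a²+|b|²)(|c₁|²+|c₂|²) + a(|c₁|²-|c₂|²) + 2 Re(c̄₁ c₂ b)` is `≤ η` (`cone_closeness`).
Kato (1966) II §5 (first-order perturbation of a degenerate eigenvalue: the eigenvalues split
according to the compression `P V P`). [folklore] -/
theorem stub_coneEnergy {ι : Type*} [Fintype ι] [DecidableEq ι]
    (K : Submodule ℂ (ι → ℂ)) (H : (Fin 2 → ℝ) → Matrix ι ι ℂ) (p : Fin 2 → ℝ)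
    (hHerm : (H p).IsHermitian)
    (hlb : ∀ φ, ∀ v ∈ K, star v ⬝ᵥ v = 1 → (H φ).minEnergyOn K ≤ (star v ⬝ᵥ H φ *ᵥ v).re)
    (hex : ∀ φ, ∃ v ∈ K, v ≠ 0 ∧ H φ *ᵥ v = (((H φ).minEnergyOn K : ℝ) : ℂ) • v)
    (V : Fin 2 → Matrix ι ι ℂ) (C : ℝ)
    (hCV : ∀ (μ : Fin 2) (x w : ι → ℂ), star x ⬝ᵥ x = 1 → star w ⬝ᵥ w = 1 →
      ‖star x ⬝ᵥ (V μ *ᵥ w)‖ ≤ C)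
    (hTaylor : ∀ ε : ℝ, 0 < ε → ∃ δ : ℝ, 0 < δ ∧ ∀ y : Fin 2 → ℝ,
      Real.sqrt (y 0 ^ 2 + y 1 ^ 2) ≤ δ → ∀ x w : ι → ℂ, star x ⬝ᵥ x = 1 → star w ⬝ᵥ w = 1 →
        ‖star x ⬝ᵥ ((H (fun ν => p ν + y ν) - H p -
            (((y 0 : ℝ) : ℂ) • V 0 + ((y 1 : ℝ) : ℂ) • V 1)) *ᵥ w)‖ ≤
          ε * Real.sqrt (y 0 ^ 2 + y 1 ^ 2))
    (e₁ e₂ : ι → ℂ) (he₁K : e₁ ∈ K) (he₂K : e₂ ∈ K) (he₁ : star e₁ ⬝ᵥ e₁ = 1)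
    (he₂ : star e₂ ⬝ᵥ e₂ = 1) (he₁₂ : star e₁ ⬝ᵥ e₂ = 0)
    (hHe₁ : H p *ᵥ e₁ = (((H p).minEnergyOn K : ℝ) : ℂ) • e₁)
    (hHe₂ : H p *ᵥ e₂ = (((H p).minEnergyOn K : ℝ) : ℂ) • e₂)
    (g : ℝ) (hg : 0 < g)
    (hgap : ∀ χ ∈ K, star e₁ ⬝ᵥ χ = 0 → star e₂ ⬝ᵥ χ = 0 → star χ ⬝ᵥ χ = 1 →
      (H p).minEnergyOn K + g ≤ (star χ ⬝ᵥ H p *ᵥ χ).re) :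
    (∀ (m ρc : ℝ), 0 < m → 0 < ρc →
      (∀ φ : Fin 2 → ℝ, 0 < (φ 0 - p 0) ^ 2 + (φ 1 - p 1) ^ 2 →
        (φ 0 - p 0) ^ 2 + (φ 1 - p 1) ^ 2 ≤ ρc ^ 2 → ∀ ψ χ : ι → ℂ,
          (ψ ∈ K ∧ ψ ≠ 0 ∧ H φ *ᵥ ψ = (((H φ).minEnergyOn K : ℝ) : ℂ) • ψ) →
          χ ∈ K → star ψ ⬝ᵥ χ = 0 → star χ ⬝ᵥ χ = 1 →
            (H φ).minEnergyOn K + m * Real.sqrt ((φ 0 - p 0) ^ 2 + (φ 1 - p 1) ^ 2) ≤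
              (star χ ⬝ᵥ (H φ *ᵥ χ)).re) →
      ∀ u : Fin 2 → ℝ, u 0 ^ 2 + u 1 ^ 2 = 1 → ∀ (a : ℝ) (b : ℂ),
        a = ((star e₁ ⬝ᵥ ((((u 0 : ℝ) : ℂ) • V 0 + ((u 1 : ℝ) : ℂ) • V 1) *ᵥ e₁)).re -
              (star e₂ ⬝ᵥ ((((u 0 : ℝ) : ℂ) • V 0 + ((u 1 : ℝ) : ℂ) • V 1) *ᵥ e₂)).re) / 2 →
        b = (star e₁ ⬝ᵥ ((((u 0 : ℝ) : ℂ) • V 0 + ((u 1 : ℝ) : ℂ) • V 1) *ᵥ e₂) +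
              star (star e₂ ⬝ᵥ ((((u 0 : ℝ) : ℂ) • V 0 + ((u 1 : ℝ) : ℂ) • V 1) *ᵥ e₁))) / 2 →
        (m / 2) ^ 2 ≤ a ^ 2 + ‖b‖ ^ 2) ∧
    (∀ η : ℝ, 0 < η → ∃ r₁ : ℝ, 0 < r₁ ∧ ∀ r : ℝ, 0 < r → r ≤ r₁ →
      ∀ u : Fin 2 → ℝ, u 0 ^ 2 + u 1 ^ 2 = 1 → ∀ (a : ℝ) (b : ℂ),
        a = ((star e₁ ⬝ᵥ ((((u 0 : ℝ) : ℂ) • V 0 + ((u 1 : ℝ) : ℂ) • V 1) *ᵥ e₁)).re -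
              (star e₂ ⬝ᵥ ((((u 0 : ℝ) : ℂ) • V 0 + ((u 1 : ℝ) : ℂ) • V 1) *ᵥ e₂)).re) / 2 →
        b = (star e₁ ⬝ᵥ ((((u 0 : ℝ) : ℂ) • V 0 + ((u 1 : ℝ) : ℂ) • V 1) *ᵥ e₂) +
              star (star e₂ ⬝ᵥ ((((u 0 : ℝ) : ℂ) • V 0 + ((u 1 : ℝ) : ℂ) • V 1) *ᵥ e₁))) / 2 →
        ∀ ψ : ι → ℂ,
          (ψ ∈ K ∧ ψ ≠ 0 ∧ H (fun ν => p ν + r * u ν) *ᵥ ψ =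
            (((H (fun ν => p ν + r * u ν)).minEnergyOn K : ℝ) : ℂ) • ψ) →
          star ψ ⬝ᵥ ψ = 1 →
            1 - ‖star e₁ ⬝ᵥ ψ‖ ^ 2 - ‖star e₂ ⬝ᵥ ψ‖ ^ 2 ≤ η ∧
            Real.sqrt (a ^ 2 + ‖b‖ ^ 2) * (‖star e₁ ⬝ᵥ ψ‖ ^ 2 + ‖star e₂ ⬝ᵥ ψ‖ ^ 2) +
                a * (‖star e₁ ⬝ᵥ ψ‖ ^ 2 - ‖star e₂ ⬝ᵥ ψ‖ ^ 2) +
                2 * (starRingEnd ℂ (star e₁ ⬝ᵥ ψ) * (star e₂ ⬝ᵥ ψ) * b).re ≤ η) :=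
  ⟨fun _ _ hm hρc hcone _ hu _ _ ha hb =>
      cone_nondegeneracy K H p hHerm hlb hex V C hCV hTaylor he₁K he₂K he₁ he₂ he₁₂ hHe₁ hHe₂ hg
        hgap hm hρc hcone hu ha hb,
    fun _ hη =>
      cone_closeness K H p hHerm hlb V C hCV hTaylor he₁K he₂K he₁ he₂ he₁₂ hHe₁ hHe₂ hg hgap hη⟩

end Summit.HubbardSuperconductivity.HubbardSuperconductivity.Theorems.NodalDiracTwist
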